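import Summits.CriticalPhenomena.PercolationContinuityZ3.Theorems.PercAnnulusCrossingIICTailTrivial
import Summits.CriticalPhenomena.PercolationContinuityZ3.Theorems.PercAnnulusCrossingIICTailRootInvariance
import Summits.CriticalPhenomena.PercolationContinuityZ3.Theorems.PercAnnulusCrossingIICAsymptoticRootInvariance
import Summits.CriticalPhenomena.PercolationContinuityZ3.Theorems.PercAnnulusCrossingIICLocalLimitShiftAll
import Summits.CriticalPhenomena.PercolationContinuityZ3.Theorems.PercAnnulusCrossingIICArmForgetsRoot
import Summits.CriticalPhenomena.PercolationContinuityZ3.Theorems.PercAnnulusCrossingIICRerootingExact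
import Summits.CriticalPhenomena.PercolationContinuityZ3.Theorems.PercAnnulusCrossingIICRerootingLebesgue
import Summits.CriticalPhenomena.PercolationContinuityZ3.Theorems.PercAnnulusCrossingIICMassTransport
import Summits.CriticalPhenomena.PercolationContinuityZ3.Theorems.PercAnnulusCrossingIICWalkStationary
import Summits.CriticalPhenomena.PercolationContinuityZ3.Theorems.PercAnnulusCrossingIICRerootingTotalVariation
import Mathlib.Probability.ConditionalProbability
import HarnessLib

/-!
# MASTER THEOREM OF p1 GEN 10: "THE IIC FORGETS" — one statement at `p_c(ℤ^d)` under (A2)□, and on `ℤ²` unconditionally (lane RSW3)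

builds on p205010 (kernel theorem, internal audit signed; external expert review pending) — through `θ(p_c) = 0`.

Seat `prim-rsw3-p1` (gen 10); memo `run/shared/lean/prim/rsw3/P1-QM.md` §23.  Helper file; no definitions, no sorries; a conjunction of the session's
headline theorems for citation in the lane documents (`ν_v = (U_v)_* ν` is the IIC rooted at `v`, `U_v ω = ω + v`; `π_n(v) = P(v ↔ ∂ⁱⁿΛ(n) in Λ(n))`):

**`iicMeasure_forgets_criticalProbI`** — `d ≥ 2`, (A2)□ at aspect `(s, L)` with `2 ≤ s`, `ν` any IIC probability measure at `p_c(ℤ^d)`: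
 (1) `ν` is tail trivial; (2) short-range correlations on all events; (3) the tail does not remember the root (`ν_v = ν` on tail events);
 (4) THE ARM FORGETS ITS ROOT (`π_n(v)/π(n) → 1`); (5) EXACT RE-ROOTING (`ν_v = ν` on `{0 ↔ v}`); (6) THE MASS-TRANSPORT PRINCIPLE (unimodularity);
 (7) stationarity of `ν` for the delayed walk on the IIC; (8) `|ν_v(A) − ν(A)| ≤ 1 − ν(0 ↔ v)` for every event.
**`iicMeasure_forgets_Z2`** — the same for Kesten's planar IIC, unconditionally.
Also `iicMeasure_map_shift_cond_openConn_eq`: the conditional form of exact re-rooting, `ν_v(· | 0 ↔ v) = ν(· | 0 ↔ v)` as measures (Mathlib `cond`).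
References: H. Kesten, PTRF 73 (1986); D. Basu, A. Sapozhnikov, ECP 22 (2017) no. 26; H.-O. Georgii (2011) Prop. 7.9; A. Járai, Ann. Probab. 31 (2003);
D. Aldous, R. Lyons, EJP 12 (2007).
-/

noncomputable section

namespace Summit.CriticalPhenomena.PercolationContinuityZ3.Theorems.Crossing

open MeasureTheory Filter Topology Literature.Probability.Percolation Literature.Probability.LatticeModels
open Literature.Probability.Percolation.DCT16
open Summit.CriticalPhenomena.PercolationContinuityZ3.Theorems.SurfaceTension
open scoped Literature.Probability.Percolation ENNReal

variable {d : ℕ}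

/-- **Exact re-rooting, conditional form**: `ν_v(· | 0 ↔ v) = ν(· | 0 ↔ v)` as measures (`θ(p) = 0`, (A2)□ at aspect `(s, L)`, `2 ≤ s`; `ν` an IIC
probability measure at `p`, `0 < p`, `d ≥ 1`): CONDITIONED ON CONTAINING `v`, KESTEN'S IIC ROOTED AT THE ORIGIN IS THE IIC ROOTED AT `v` CONDITIONED ON CONTAINING
THE ORIGIN. [cite: BasuSapozhnikov2017ECP, Thm. 1.1 and Remark 2.1] [cite: Kesten1986, Thm. (3)] [cite: Jarai2003, Thm. 1] -/
theorem iicMeasure_map_shift_cond_openConn_eq (hd : 1 ≤ d) (p : unitInterval) (hp : 0 < (p : ℝ)) (hθ : theta (zdGraph d) 0 p = 0)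
    {s L : ℕ} (hs : 2 ≤ s) {ϰ : ℝ} (hϰ : 0 < ϰ) (hA2 : SetToSetQuasiMultAspectAt d p s L ϰ)
    {ν : Measure (BondConfig (Site d))} [IsProbabilityMeasure ν]
    (hν : ∀ (F : Finset (Sym2 (Site d))) (E : Set (BondConfig (Site d))), MeasurableSet E → DeterminedBy E ↑F →
      Tendsto (fun n : ℕ => (bondPercolation (zdGraph d) p).real (E ∩ siteToBoundary d n) / oneArmProb d p n)
        atTop (𝓝 (ν.real E)))
    (v : Site d) :
    ProbabilityTheory.cond (ν.map (BondConfig.relabel (sym2Equiv (Site.shift v)))) (openConn (0 : Site d) v) =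
      ProbabilityTheory.cond ν (openConn (0 : Site d) v) := by
  have h := iicMeasure_map_shift_restrict_openConn_eq hd p hp hθ hs hϰ hA2 hν v
  have hO : (ν.map (BondConfig.relabel (sym2Equiv (Site.shift v)))) (openConn (0 : Site d) v) = ν (openConn (0 : Site d) v) := by
    rw [← Measure.restrict_apply_univ, h, Measure.restrict_apply_univ]
  unfold ProbabilityTheory.cond
  rw [h, hO]

/-- **"THE IIC FORGETS" AT `p_c(ℤ^d)`** (`d ≥ 2`, (A2)□ at aspect `(s, L)`, `2 ≤ s`, `ϰ > 0`; `ν` any probability measure with Kesten's IIC limit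
property at `p_c`): (1) tail triviality; (2) short-range correlations on ALL events; (3) `ν_v = ν` on tail events; (4) `π_n(v)/π_{p_c}(n) → 1`;
(5) `ν_v(E ∩ {0 ↔ v}) = ν(E ∩ {0 ↔ v})`; (6) the mass-transport principle; (7) stationarity for the delayed walk; (8) `|ν_v(A) − ν(A)| ≤ 1 − ν(0 ↔ v)`.
[cite: Kesten1986, Thm. (3)] [cite: BasuSapozhnikov2017ECP, Thm. 1.1 and Remark 2.1] [cite: Georgii2011, Prop. 7.9] [cite: AldousLyons2007, §2] -/
theorem iicMeasure_forgets_criticalProbI (hd : 2 ≤ d) {s L : ℕ} (hs : 2 ≤ s) {ϰ : ℝ} (hϰ : 0 < ϰ)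
    (hA2 : SetToSetQuasiMultAspectAt d (criticalProbI d) s L ϰ)
    (ν : Measure (BondConfig (Site d))) [IsProbabilityMeasure ν]
    (hν : ∀ (F : Finset (Sym2 (Site d))) (E : Set (BondConfig (Site d))), MeasurableSet E → DeterminedBy E ↑F →
      Tendsto (fun n : ℕ => (bondPercolation (zdGraph d) (criticalProbI d)).real (E ∩ siteToBoundary d n) /
        oneArmProb d (criticalProbI d) n) atTop (𝓝 (ν.real E))) :
    IsTailTrivial (V := Sym2 (Site d)) (S := Prop) ν ∧
    (∀ (A : Set (BondConfig (Site d))), MeasurableSet A → ∀ ε : ℝ, 0 < ε →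
      ∃ K : ℕ, ∀ G : Set (BondConfig (Site d)), MeasurableSet G →
        DeterminedBy G {e : Sym2 (Site d) | e ∉ (↑((box d K).sym2) : Set (Sym2 (Site d)))} →
          |ν.real (A ∩ G) - ν.real A * ν.real G| ≤ ε) ∧
    (∀ (v : Site d) (G : Set (BondConfig (Site d))), MeasurableSet G →
      (∀ K : ℕ, DeterminedBy G {e : Sym2 (Site d) | e ∉ (↑((box d K).sym2) : Set (Sym2 (Site d)))}) →
        (ν.map (BondConfig.relabel (sym2Equiv (Site.shift v)))).real G = ν.real G) ∧
    (∀ v : Site d, Tendsto (fun n : ℕ => (bondPercolation (zdGraph d) (criticalProbI d)).real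
        {ω | ∃ t ∈ innerBoundary (zdGraph d) (box d n), ω ∈ openConnIn (↑(box d n) : Set (Site d)) v t} /
          oneArmProb d (criticalProbI d) n) atTop (𝓝 1)) ∧
    (∀ (v : Site d) (E : Set (BondConfig (Site d))), MeasurableSet E →
      (ν.map (BondConfig.relabel (sym2Equiv (Site.shift v)))).real (E ∩ openConn (0 : Site d) v) = ν.real (E ∩ openConn (0 : Site d) v)) ∧
    (∀ f : Site d → Site d → BondConfig (Site d) → ℝ≥0∞,
      (∀ (x y w : Site d) (ω : BondConfig (Site d)), f (x + w) (y + w) (BondConfig.relabel (sym2Equiv (Site.shift w)) ω) = f x y ω) →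
        ∑' v : Site d, ∫⁻ ω in openConn (0 : Site d) v, f 0 v ω ∂ν = ∑' v : Site d, ∫⁻ ω in openConn (0 : Site d) v, f v 0 ω ∂ν) ∧
    (∀ (S : Finset (Site d)), (∀ y ∈ S, -y ∈ S) → ∀ E : Set (BondConfig (Site d)), MeasurableSet E →
      (S.card : ℝ) * ν.real E =
        ∑ y ∈ S, (ν.real ({ω | s((0 : Site d), y) ∈ ω} ∩ BondConfig.relabel (sym2Equiv (Site.shift (-y))) ⁻¹' E) +
          ν.real ({ω | s((0 : Site d), y) ∉ ω} ∩ E))) ∧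
    (∀ (v : Site d) (A : Set (BondConfig (Site d))), MeasurableSet A →
      |(ν.map (BondConfig.relabel (sym2Equiv (Site.shift v)))).real A - ν.real A| ≤ 1 - ν.real (openConn (0 : Site d) v)) :=
  ⟨iicMeasure_isTailTrivial_criticalProbI hd hs hϰ hA2 hν,
   fun _ hA _ hε => iicMeasure_exists_forall_abs_real_inter_sub_mul_le_criticalProbI hd hs hϰ hA2 hν hA hε,
   fun v _ hGm hGtail => iicMeasure_map_shift_real_eq_of_tail_criticalProbI hd hs hϰ hA2 hν v hGm hGtail,
   fun v => tendsto_arm_at_div_oneArmProb_criticalProbI hd hs hϰ hA2 hν v,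
   fun v _ hE => iicMeasure_map_shift_real_inter_openConn_eq_criticalProbI hd hs hϰ hA2 hν v hE,
   fun f hf => iicMeasure_mass_transport_criticalProbI hd hs hϰ hA2 hν f hf,
   fun S hS _ hE => iicMeasure_delayed_walk_stationary_criticalProbI hd hs hϰ hA2 hν S hS hE,
   fun v _ hA => abs_iicMeasure_map_shift_real_sub_real_le_criticalProbI hd hs hϰ hA2 hν v hA⟩

/-- **"THE IIC FORGETS" FOR KESTEN'S PLANAR IIC, UNCONDITIONALLY** (every probability measure `ν` with the IIC limit property at `p_c(ℤ²) = 1/2`; such `ν`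
exists, p1 gen 6): the eight statements of `iicMeasure_forgets_criticalProbI`. [cite: Kesten1986, Thm. (3)] [cite: Georgii2011, Prop. 7.9] [cite: Jarai2003, Thm. 1]
[cite: AldousLyons2007, §2] -/
theorem iicMeasure_forgets_Z2 (ν : Measure (BondConfig (Site 2))) [IsProbabilityMeasure ν]
    (hν : ∀ (F : Finset (Sym2 (Site 2))) (E : Set (BondConfig (Site 2))), MeasurableSet E → DeterminedBy E ↑F →
      Tendsto (fun n : ℕ => (bondPercolation (zdGraph 2) (criticalProbI 2)).real (E ∩ siteToBoundary 2 n) /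
        oneArmProb 2 (criticalProbI 2) n) atTop (𝓝 (ν.real E))) :
    IsTailTrivial (V := Sym2 (Site 2)) (S := Prop) ν ∧
    (∀ (A : Set (BondConfig (Site 2))), MeasurableSet A → ∀ ε : ℝ, 0 < ε →
      ∃ K : ℕ, ∀ G : Set (BondConfig (Site 2)), MeasurableSet G →
        DeterminedBy G {e : Sym2 (Site 2) | e ∉ (↑((box 2 K).sym2) : Set (Sym2 (Site 2)))} →
          |ν.real (A ∩ G) - ν.real A * ν.real G| ≤ ε) ∧
    (∀ (v : Site 2) (G : Set (BondConfig (Site 2))), MeasurableSet G →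
      (∀ K : ℕ, DeterminedBy G {e : Sym2 (Site 2) | e ∉ (↑((box 2 K).sym2) : Set (Sym2 (Site 2)))}) →
        (ν.map (BondConfig.relabel (sym2Equiv (Site.shift v)))).real G = ν.real G) ∧
    (∀ v : Site 2, Tendsto (fun n : ℕ => (bondPercolation (zdGraph 2) (criticalProbI 2)).real
        {ω | ∃ t ∈ innerBoundary (zdGraph 2) (box 2 n), ω ∈ openConnIn (↑(box 2 n) : Set (Site 2)) v t} /
          oneArmProb 2 (criticalProbI 2) n) atTop (𝓝 1)) ∧
    (∀ (v : Site 2) (E : Set (BondConfig (Site 2))), MeasurableSet E →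
      (ν.map (BondConfig.relabel (sym2Equiv (Site.shift v)))).real (E ∩ openConn (0 : Site 2) v) = ν.real (E ∩ openConn (0 : Site 2) v)) ∧
    (∀ f : Site 2 → Site 2 → BondConfig (Site 2) → ℝ≥0∞,
      (∀ (x y w : Site 2) (ω : BondConfig (Site 2)), f (x + w) (y + w) (BondConfig.relabel (sym2Equiv (Site.shift w)) ω) = f x y ω) →
        ∑' v : Site 2, ∫⁻ ω in openConn (0 : Site 2) v, f 0 v ω ∂ν = ∑' v : Site 2, ∫⁻ ω in openConn (0 : Site 2) v, f v 0 ω ∂ν) ∧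
    (∀ (S : Finset (Site 2)), (∀ y ∈ S, -y ∈ S) → ∀ E : Set (BondConfig (Site 2)), MeasurableSet E →
      (S.card : ℝ) * ν.real E =
        ∑ y ∈ S, (ν.real ({ω | s((0 : Site 2), y) ∈ ω} ∩ BondConfig.relabel (sym2Equiv (Site.shift (-y))) ⁻¹' E) +
          ν.real ({ω | s((0 : Site 2), y) ∉ ω} ∩ E))) ∧
    (∀ (v : Site 2) (A : Set (BondConfig (Site 2))), MeasurableSet A →
      |(ν.map (BondConfig.relabel (sym2Equiv (Site.shift v)))).real A - ν.real A| ≤ 1 - ν.real (openConn (0 : Site 2) v)) := by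
  obtain ⟨ϰ, hϰ, hA2⟩ := exists_setToSetQuasiMultAspectAt_two_of_criticalProbI_le
  exact iicMeasure_forgets_criticalProbI (d := 2) le_rfl (s := 9) (L := 77) (by norm_num) hϰ (hA2 _ le_rfl) ν hν

end Summit.CriticalPhenomena.PercolationContinuityZ3.Theorems.Crossing

end
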